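import Mathlib
import HarnessLib
import Summits.HubbardSuperconductivity.HubbardSuperconductivity.Theorems.KLProgrammeKLRegimeFrameBandPi
import Summits.HubbardSuperconductivity.HubbardSuperconductivity.Theorems.KLProgrammeH10TwoPointLimitSymbolCellGeometry
import Literature.MathematicalPhysics.QuantumLattice.HubbardScaleReport

/-!
# Route `KLProgramme` — engine support (route (L2)): the tangential datum of the slice profile from the CELL data of the multiplier —
# Euclidean `|De_K(toLp c(k))·toLp w| ≤ τ₀ + K₂·√2ρ·‖toLp w‖` from the Pi-side `|D(e_K∘toLp)(p_F)·w| ≤ τ₀` and `‖c(k) − p_F‖_∞ ≤ ρ`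

Cell `gate-hubbard-kl`, seat hubbard-kl-k3c2-p3; gen-4 ENGINE child stmt-HubbardSuperconductivity-19855 (`stub_engine_step_norms`, propagator
`α_n`).  `slicePair_charSum_l1_le` takes the tangency hypothesis `hτ` in EUCLIDEAN form at the torus points of the multiplier support; the p4
lineage's assembly delivers it in Pi form at the Fermi point `p_F` of the sector (`hτ₀`) together with the cell radius (`frameBand_cell`:
`‖p − p_F‖_∞ ≤ ρ` on the support).  The bridge:

* **`abs_fderiv_frameLevel_toLp_le_of_near`** — for any `c, p_F, w : Fin 2 → ℝ` with `‖c − p_F‖ ≤ ρ`: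
  `|De_K(toLp c)·(toLp w)| ≤ τ₀ + K₂·(√2·ρ)·‖toLp w‖`;
* **`sliceTangency_of_cell`** — the `hτ` hypothesis of `slicePair_charSum_l1_le` (at `c = c(q₂)`, `w = (2π/L)·v`) from
  «`M q ≠ 0 ⇒ ‖c(q₂) − p_F‖ ≤ ρ`» and `hτ₀`.

Everything is proved; no definitions, no named facts. [folklore]
-/

noncomputable section

namespace Summit.HubbardSuperconductivity.HubbardSuperconductivity.Theorems.TorusFourierL2

set_option linter.dupNamespace false -- summit = problem name (single-conjunct summit), D-0017

open Literature.MathematicalPhysics.QuantumLattice Literature.Probability.LatticeModels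
open Summit.HubbardSuperconductivity.HubbardSuperconductivity.Theorems.DispersionFlow
open scoped Real

/-- **Euclidean tangential datum near the Fermi point from the Pi-side datum at the Fermi point.** [folklore] -/
theorem abs_fderiv_frameLevel_toLp_le_of_near (μ : ℝ) (K : TrigPolyC4v) {K₂ : ℝ}
    (hK₂ : ∀ x, ‖iteratedFDeriv ℝ 2 (frameLevel μ K) x‖ ≤ K₂) (pF c w : Fin 2 → ℝ) {τ₀ ρ : ℝ}
    (hτ₀ : |fderiv ℝ (fun p : Fin 2 → ℝ => frameLevel μ K (WithLp.toLp 2 p)) pF w| ≤ τ₀) (hρ : ‖c - pF‖ ≤ ρ) :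
    |fderiv ℝ (frameLevel μ K) (WithLp.toLp 2 c) (WithLp.toLp 2 w)| ≤
      τ₀ + K₂ * (Real.sqrt 2 * ρ) * ‖(WithLp.toLp 2 w : EuclideanSpace ℝ (Fin 2))‖ := by
  have hK0 : 0 ≤ K₂ := le_trans (norm_nonneg _) (hK₂ 0)
  rw [fderiv_frameLevelPi_apply] at hτ₀
  have h := abs_fderiv_apply_le_of_near (EngineV8.contDiff_frameLevel μ K) hK₂ (WithLp.toLp 2 pF) (WithLp.toLp 2 c) (WithLp.toLp 2 w)
  have hdist : ‖(WithLp.toLp 2 c : EuclideanSpace ℝ (Fin 2)) - WithLp.toLp 2 pF‖ ≤ Real.sqrt 2 * ρ := by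
    rw [← WithLp.toLp_sub]
    exact (norm_toLp_le (c - pF)).trans (mul_le_mul_of_nonneg_left hρ (Real.sqrt_nonneg 2))
  have h2 : K₂ * ‖(WithLp.toLp 2 c : EuclideanSpace ℝ (Fin 2)) - WithLp.toLp 2 pF‖ * ‖(WithLp.toLp 2 w : EuclideanSpace ℝ (Fin 2))‖ ≤
      K₂ * (Real.sqrt 2 * ρ) * ‖(WithLp.toLp 2 w : EuclideanSpace ℝ (Fin 2))‖ :=
    mul_le_mul_of_nonneg_right (mul_le_mul_of_nonneg_left hdist hK0) (norm_nonneg _)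
  linarith

/-- **The `hτ` hypothesis of `slicePair_charSum_l1_le` from cell data**: if every torus point of the multiplier support lies within `ρ` (sup
norm) of `p_F`, and `|D(e_K∘toLp)(p_F)·((2π/L)·v)| ≤ τ₀`, then at every support point
`|De_K(toLp c(q₂))·toLp((2π/L)·v)| ≤ τ₀ + K₂·√2ρ·‖toLp((2π/L)·v)‖`. [folklore] -/
theorem sliceTangency_of_cell {L M : ℕ} [NeZero L] (μ : ℝ) (K : TrigPolyC4v) {K₂ : ℝ}
    (hK₂ : ∀ x, ‖iteratedFDeriv ℝ 2 (frameLevel μ K) x‖ ≤ K₂) (Mf : TorusSite 1 (2 * M) × TorusSite 2 L → ℂ)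
    (v : Fin 2 → ℤ) (pF : Fin 2 → ℝ) {τ₀ ρ : ℝ}
    (hτ₀ : |fderiv ℝ (fun p : Fin 2 → ℝ => frameLevel μ K (WithLp.toLp 2 p)) pF (fun i => 2 * π / L * (v i : ℝ))| ≤ τ₀)
    (hcell : ∀ q, Mf q ≠ 0 → ‖torusCentredMomentum L q.2 - pF‖ ≤ ρ) (q : TorusSite 1 (2 * M) × TorusSite 2 L) (hq : Mf q ≠ 0) :
    |fderiv ℝ (frameLevel μ K) (WithLp.toLp 2 (torusCentredMomentum L q.2)) (WithLp.toLp 2 (fun i => 2 * π / L * (v i : ℝ)))| ≤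
      τ₀ + K₂ * (Real.sqrt 2 * ρ) * ‖(WithLp.toLp 2 (fun i => 2 * π / L * (v i : ℝ)) : EuclideanSpace ℝ (Fin 2))‖ :=
  abs_fderiv_frameLevel_toLp_le_of_near μ K hK₂ pF _ _ hτ₀ (hcell q hq)

end Summit.HubbardSuperconductivity.HubbardSuperconductivity.Theorems.TorusFourierL2

end
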